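import Literature.AlgebraicGeometry.Resolution.DerivativeIdeals
import HarnessLib

/-!
# Differential operators of order `≤ n` (EGA IV₄ §16.8) and the ideals `Diff^{≤ n}(I)` — ring level

Topic: `Literature/AlgebraicGeometry/Resolution`; definition item `defn-HasseSchmidtDiff` (route
`ResolutionOfSingularities/MarkedTransfer`, tame/wild split of the crux `HypersurfaceOrderReduction`:
in characteristic `p` the iterated FIRST-order derivative ideals `derivIdealIter` of
`DerivativeIdeals.lean` are too small — `∂(x^p) = 0` — and must be replaced by Grothendieck's
differential operators of higher order, e.g. the Hasse–Schmidt derivative `D^{(p)}` with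
`D^{(p)}(x^p) = 1`). This file is the general commutative-algebra layer, for an `R`-algebra `A`
(sections over an affine open of a smooth `R = k`-scheme); the polynomial-ring layer — the
Hasse–Schmidt (divided, Taylor) derivatives `D^{(α)}`, `D^{(α)}(x^β) = (β choose α) x^{β-α}`, which lie in
`Diff^{≤ |α|}` in every characteristic, and the order criterion at a rational point — is
`HasseSchmidtDerivatives.lean`.

Grothendieck, EGA IV₄ (Publ. Math. IHÉS 32, 1967), §16.8: Déf. 16.8.1 (differential operators of
order `≤ n` through the sheaf of principal parts `P^n_{X/S}`) and **Prop. 16.8.8** — "Les conditions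
suivantes sont équivalentes : a) `D` est un opérateur différentiel d'ordre `≤ n`. b) Pour toute
section `a` de `𝒪_X` …, l'homomorphisme `D_a … D_a(t) = D(at) − aD(t)` est un opérateur différentiel
d'ordre `≤ n − 1`. c) … `Σ_{H ⊆ I_{n+1}} (−1)^{card H} (∏_{i∈H} a_i) D((∏_{i∉H} a_i) t) = 0`" (with the
convention "tout opérateur différentiel d'ordre `< 0` est nul"); **Prop. 16.8.9** — "Si `D` est …
d'ordre `≤ n`, et `D'` … d'ordre `≤ n'`, alors `D' ∘ D` … est … d'ordre `≤ n + n'`." We take (b) as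
the DEFINITION (it only mentions `R`-linear endomorphisms of `A`, no module of principal parts):

* `commMul R D a = [D, a]`, `t ↦ D (a t) − a D t`;
* `IsDiffOpLE R n D` — by recursion on `n`: order `≤ 0` iff every `[D, a]` vanishes (i.e. `D` is
  `A`-linear, `= (D 1)·`, `isDiffOpLE_zero_iff_eq_mulLeft`), order `≤ n + 1` iff every `[D, a]` has
  order `≤ n`; `diffOp R A n = Diff^{≤ n}_{A/R}`, the `A`-submodule of `A →ₗ[R] A` they form
  (`A` acting by post-multiplication);
* API (all proved): `IsDiffOpLE.zero/add/neg/sub/smul/sum`, `IsDiffOpLE.mono/of_le` (EGA 16.8.1: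
  `Diff^{≤ n} ⊆ Diff^{≤ n+1}`), `isDiffOpLE_mulLeft` and `isDiffOpLE_id` (order `0`),
  `Derivation.isDiffOpLE_one` (derivations have order `≤ 1`), **`IsDiffOpLE.comp`** (EGA 16.8.9,
  orders add), **`IsDiffOpLE.apply_mem_pow_sub`** — `D ∈ Diff^{≤ n}`, `f ∈ P^m ⇒ D f ∈ P^{m−n}` (the
  higher-order Leibniz estimate, every characteristic);
* `diffIdeal R n I = Diff^{≤ n}(I)` — the ideal generated by `{D f : D ∈ Diff^{≤ n}, f ∈ I}`
  (Villamayor: "`Diff^{b−1}_k(I)`"; Kollár's `D^{n}(I)` in characteristic `0`); `le_diffIdeal`,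
  `apply_mem_diffIdeal`, `diffIdeal_le_iff`, `diffIdeal_mono`, `diffIdeal_mono_left`,
  `diffIdeal_zero` (`Diff^{≤ 0}(I) = I`), `derivIdeal_le_diffIdeal_one` (`𝒟(I) ⊆ Diff^{≤ 1}(I)`),
  **`diffIdeal_le_pow_sub`** — `I ⊆ P^m ⇒ Diff^{≤ n}(I) ⊆ P^{m−n}`, i.e. `ord_P I ≥ m ⇒
  Diff^{≤ m−1}(I) ⊆ P` (the characteristic-free half of the order criterion; the converse at
  rational points of affine space is proved in `HasseSchmidtDerivatives.lean`).

## Design notes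

* Operators are `R`-linear endomorphisms `A →ₗ[R] A` (EGA's `D : 𝒪_X → 𝒪_X`, `f^{-1}(𝒪_S)`-linear);
  the `A`-module structure on `A →ₗ[R] A` is Mathlib's `LinearMap.module` (`(b • D) t = b * D t`).
* The recursion on `n : ℕ` starts at order `≤ 0` = "all commutators vanish", which is EGA's
  order `≤ 0` (𝒪_X-linear maps) under the convention that order `< 0` means `0`; the closed form
  16.8.8 (c) is not restated.
* No sheafification here (as for `derivIdeal`: the sheaf `Diff^{≤ n}_{X/k}(𝓘)` on a smooth
  `k`-scheme is glued from these affine pieces in a later file; localisation / étale-invariance of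
  `Diff^{≤ n}` — EGA IV₄ 16.8.? / 16.4.14 — are not needed to state the route's split).

## References

* [EGAIV4] A. Grothendieck, J. Dieudonné, ÉGA IV₄, Publ. Math. IHÉS 32 (1967), Déf. 16.8.1,
  Prop. 16.8.8, Prop. 16.8.9, Cor. 16.8.10. Read via `lit read doi:10.1007/BF02732123` (pp. 38–44
  of the held copy).
* [VillamayorU2008ReesDiff] O. Villamayor U., *Rees algebras on smooth schemes: integral closure
  and higher differential operators*, Rev. Mat. Iberoam. 24 (2008) = arXiv:math/0606795, Def. 3.2–
  3.3 (Diff-algebras: `D(I_n) ⊆ I_{n−r}` for `D ∈ Diff^{(r)}`), §4.1 (`V(Diff^{b−1}_k(I))` = points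
  of order `≥ b`).
* [Kollar2007] J. Kollár, *Lectures on resolution of singularities*, §3.7 (derivative ideals
  `D^i(I)`, Lemma 3.74 — characteristic `0`).
-/

namespace Literature.AlgebraicGeometry.Resolution

section General

variable (R : Type*) {A : Type*} [CommSemiring R] [CommRing A] [Algebra R A]

/-! ### The commutator with a multiplication -/

/-- `commMul R D a = [D, a]`: the `R`-linear endomorphism `t ↦ D (a t) − a D t` of `A` (EGA's `D_a`,
16.8.8.1). [cite: EGAIV4, Prop. 16.8.8 (16.8.8.1)] -/
def commMul (D : A →ₗ[R] A) (a : A) : A →ₗ[R] A :=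
  D ∘ₗ LinearMap.mulLeft R a - LinearMap.mulLeft R a ∘ₗ D

/-- `[D, a] t = D (a t) − a D t`. [cite: EGAIV4, Prop. 16.8.8 (16.8.8.1)] -/
@[simp] theorem commMul_apply (D : A →ₗ[R] A) (a t : A) : commMul R D a t = D (a * t) - a * D t :=
  rfl

/-- `[0, a] = 0`. [folklore] -/
@[simp] theorem commMul_zero_left (a : A) : commMul R (0 : A →ₗ[R] A) a = 0 := by
  ext t; simp

/-- `[D + E, a] = [D, a] + [E, a]`. [folklore] -/
theorem commMul_add_left (D E : A →ₗ[R] A) (a : A) :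
    commMul R (D + E) a = commMul R D a + commMul R E a := by
  ext t; simp only [commMul_apply, LinearMap.add_apply]; ring

/-- `[-D, a] = -[D, a]`. [folklore] -/
theorem commMul_neg_left (D : A →ₗ[R] A) (a : A) : commMul R (-D) a = -commMul R D a := by
  ext t; simp only [commMul_apply, LinearMap.neg_apply]; ring

/-- `[b • D, a] = b • [D, a]` (`A` commutative). [folklore] -/
theorem commMul_smul_left (b : A) (D : A →ₗ[R] A) (a : A) :
    commMul R (b • D) a = b • commMul R D a := by
  ext t; simp only [commMul_apply, LinearMap.smul_apply, smul_eq_mul]; ring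

/-- `[D ∘ E, a] = [D, a] ∘ E + D ∘ [E, a]`. [cite: EGAIV4, Prop. 16.8.9 (proof)] -/
theorem commMul_comp (D E : A →ₗ[R] A) (a : A) :
    commMul R (D ∘ₗ E) a = commMul R D a ∘ₗ E + D ∘ₗ commMul R E a := by
  ext t; simp only [commMul_apply, LinearMap.comp_apply, LinearMap.add_apply, map_sub]; ring

/-- Multiplications commute with multiplications: `[b·, a] = 0`. [folklore] -/
@[simp] theorem commMul_mulLeft (b a : A) : commMul R (LinearMap.mulLeft R b) a = 0 := by
  ext t; simp only [commMul_apply, LinearMap.mulLeft_apply, LinearMap.zero_apply]; ring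

/-- The commutator of a derivation with `a` is multiplication by `δ a`. [folklore] -/
theorem commMul_derivation (δ : Derivation R A A) (a : A) :
    commMul R (δ : A →ₗ[R] A) a = LinearMap.mulLeft R (δ a) := by
  ext t
  simp only [commMul_apply, Derivation.coeFn_coe, Derivation.leibniz, smul_eq_mul,
    LinearMap.mulLeft_apply]
  ring

/-! ### Differential operators of order `≤ n` -/

/-- **`IsDiffOpLE R n D`: the `R`-linear endomorphism `D` of `A` is a differential operator of
order `≤ n`** (relative to `R`), defined by Grothendieck's recursive criterion EGA IV₄ 16.8.8 (b):
order `≤ 0` iff `[D, a] = 0` for all `a` (i.e. `D` is `A`-linear), and order `≤ n + 1` iff `[D, a]`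
has order `≤ n` for all `a ∈ A`. Equivalently (16.8.8 (c)) all `(n+1)`-fold iterated commutators
`[[…[D, a₀], …], a_n]` vanish. [cite: EGAIV4, Déf. 16.8.1 and Prop. 16.8.8 (b)] -/
def IsDiffOpLE : ℕ → (A →ₗ[R] A) → Prop
  | 0, D => ∀ a : A, commMul R D a = 0
  | n + 1, D => ∀ a : A, IsDiffOpLE n (commMul R D a)

/-- Order `≤ 0`: all commutators with multiplications vanish. [cite: EGAIV4, Prop. 16.8.8] -/
theorem isDiffOpLE_zero_iff {D : A →ₗ[R] A} : IsDiffOpLE R 0 D ↔ ∀ a : A, commMul R D a = 0 :=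
  Iff.rfl

/-- Order `≤ n + 1`: all commutators with multiplications have order `≤ n`.
[cite: EGAIV4, Prop. 16.8.8 (b)] -/
theorem isDiffOpLE_succ_iff {n : ℕ} {D : A →ₗ[R] A} :
    IsDiffOpLE R (n + 1) D ↔ ∀ a : A, IsDiffOpLE R n (commMul R D a) :=
  Iff.rfl

variable {R}

namespace IsDiffOpLE

/-- `0` has every order. [folklore] -/
theorem zero : ∀ n : ℕ, IsDiffOpLE R n (0 : A →ₗ[R] A)
  | 0 => fun a => commMul_zero_left R a
  | n + 1 => fun a => by rw [commMul_zero_left]; exact zero n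

/-- Sums of operators of order `≤ n` have order `≤ n`. [cite: EGAIV4, Déf. 16.8.1 (Diff^n is a module)] -/
theorem add : ∀ {n : ℕ} {D E : A →ₗ[R] A}, IsDiffOpLE R n D → IsDiffOpLE R n E → IsDiffOpLE R n (D + E)
  | 0, D, E, hD, hE => fun a => by rw [commMul_add_left, hD a, hE a, add_zero]
  | n + 1, D, E, hD, hE => fun a => by rw [commMul_add_left]; exact add (hD a) (hE a)

/-- `A`-multiples of operators of order `≤ n` have order `≤ n`. [cite: EGAIV4, Déf. 16.8.1 (Diff^n is an 𝒪_X-module)] -/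
theorem smul (b : A) : ∀ {n : ℕ} {D : A →ₗ[R] A}, IsDiffOpLE R n D → IsDiffOpLE R n (b • D)
  | 0, D, hD => fun a => by rw [commMul_smul_left, hD a, smul_zero]
  | n + 1, D, hD => fun a => by rw [commMul_smul_left]; exact smul b (hD a)

/-- Negatives. [folklore] -/
theorem neg : ∀ {n : ℕ} {D : A →ₗ[R] A}, IsDiffOpLE R n D → IsDiffOpLE R n (-D)
  | 0, D, hD => fun a => by rw [commMul_neg_left, hD a, neg_zero]
  | n + 1, D, hD => fun a => by rw [commMul_neg_left]; exact neg (hD a)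

/-- Differences. [folklore] -/
theorem sub {n : ℕ} {D E : A →ₗ[R] A} (hD : IsDiffOpLE R n D) (hE : IsDiffOpLE R n E) :
    IsDiffOpLE R n (D - E) := by
  rw [sub_eq_add_neg]; exact hD.add hE.neg

/-- Finite sums. [folklore] -/
theorem sum {ι : Type*} {n : ℕ} (s : Finset ι) {D : ι → A →ₗ[R] A}
    (h : ∀ i ∈ s, IsDiffOpLE R n (D i)) : IsDiffOpLE R n (∑ i ∈ s, D i) := by
  classical
  induction s using Finset.induction_on with
  | empty => simpa using zero n
  | insert i s hi ih =>
    rw [Finset.sum_insert hi]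
    exact (h i (Finset.mem_insert_self i s)).add (ih fun j hj => h j (Finset.mem_insert_of_mem hj))

/-- **`Diff^{≤ n} ⊆ Diff^{≤ n+1}`.** [cite: EGAIV4, Déf. 16.8.1 (16.7.7: order ≤ n ⇒ order ≤ m for n ≤ m)] -/
theorem mono : ∀ {n : ℕ} {D : A →ₗ[R] A}, IsDiffOpLE R n D → IsDiffOpLE R (n + 1) D
  | 0, D, hD => fun a => by rw [hD a]; exact zero 0
  | n + 1, D, hD => fun a => mono (hD a)

/-- Monotonicity in the order. [cite: EGAIV4, Déf. 16.8.1] -/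
theorem of_le {m n : ℕ} (h : m ≤ n) {D : A →ₗ[R] A} (hD : IsDiffOpLE R m D) : IsDiffOpLE R n D := by
  obtain ⟨k, rfl⟩ := Nat.exists_eq_add_of_le h
  induction k with
  | zero => exact hD
  | succ k ih => exact (ih (Nat.le_add_right m k)).mono

/-- The commutators of an operator of order `≤ n + 1` have order `≤ n` (the defining clause).
[cite: EGAIV4, Prop. 16.8.8 (b)] -/
theorem of_succ {n : ℕ} {D : A →ₗ[R] A} (hD : IsDiffOpLE R (n + 1) D) (a : A) :
    IsDiffOpLE R n (Resolution.commMul R D a) :=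
  hD a

/-- **Orders add under composition** (EGA IV₄ 16.8.9): `D ∈ Diff^{≤ m}`, `E ∈ Diff^{≤ n}` ⇒
`D ∘ E ∈ Diff^{≤ m+n}` (from `[D ∘ E, a] = [D, a] ∘ E + D ∘ [E, a]`, by induction on `m + n`).
[cite: EGAIV4, Prop. 16.8.9] -/
theorem comp {m n : ℕ} {D E : A →ₗ[R] A} (hD : IsDiffOpLE R m D) (hE : IsDiffOpLE R n E) :
    IsDiffOpLE R (m + n) (D ∘ₗ E) := by
  suffices ∀ k m n (D E : A →ₗ[R] A), m + n = k → IsDiffOpLE R m D → IsDiffOpLE R n E →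
      IsDiffOpLE R (m + n) (D ∘ₗ E) from this _ _ _ _ _ rfl hD hE
  intro k
  induction k with
  | zero =>
    intro m n D E hk hD hE
    obtain ⟨rfl, rfl⟩ : m = 0 ∧ n = 0 := by omega
    intro a
    rw [commMul_comp, hD a, hE a, LinearMap.zero_comp, LinearMap.comp_zero, add_zero]
  | succ k ih =>
    intro m n D E hk hD hE
    cases m with
    | zero =>
      cases n with
      | zero => omega
      | succ n =>
        -- `[D ∘ E, a] = D ∘ [E, a]` of order `0 + n`
        intro a
        rw [commMul_comp, hD a, LinearMap.zero_comp, zero_add]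
        exact ih 0 n D _ (by omega) hD (hE a)
    | succ m =>
      rw [show m + 1 + n = (m + n) + 1 by omega]
      intro a
      rw [commMul_comp]
      refine IsDiffOpLE.add (ih m n _ E (by omega) (hD a) hE) ?_
      cases n with
      | zero => rw [hE a, LinearMap.comp_zero]; exact zero _
      | succ n =>
        rw [show m + (n + 1) = (m + 1) + n by omega]
        exact ih (m + 1) n D _ (by omega) hD (hE a)

end IsDiffOpLE

/-- Multiplication by `b` has order `≤ 0`. [cite: EGAIV4, Déf. 16.8.1 (Diff^0 = Hom_{𝒪_X})] -/
theorem isDiffOpLE_mulLeft (b : A) : IsDiffOpLE R 0 (LinearMap.mulLeft R b) :=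
  fun a => commMul_mulLeft R b a

/-- The identity has order `≤ 0`. [cite: EGAIV4, Déf. 16.8.1] -/
theorem isDiffOpLE_id : IsDiffOpLE R 0 (LinearMap.id : A →ₗ[R] A) := by
  rw [← LinearMap.mulLeft_one]; exact isDiffOpLE_mulLeft 1

/-- **Order `≤ 0` = `A`-linear = multiplications**: `D ∈ Diff^{≤ 0}` iff `D = (D 1)·`.
[cite: EGAIV4, Déf. 16.8.1 (Diff^0_{X/S}(𝒪_X, 𝒪_X) = Hom_{𝒪_X}(𝒪_X, 𝒪_X))] -/
theorem isDiffOpLE_zero_iff_eq_mulLeft {D : A →ₗ[R] A} :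
    IsDiffOpLE R 0 D ↔ D = LinearMap.mulLeft R (D 1) := by
  constructor
  · intro h
    ext t
    have := congrArg (fun L : A →ₗ[R] A => L 1) (h t)
    simp only [commMul_apply, mul_one, LinearMap.zero_apply, sub_eq_zero] at this
    rw [LinearMap.mulLeft_apply, mul_comm, this]
  · intro h; rw [h]; exact isDiffOpLE_mulLeft _

/-- **Derivations are differential operators of order `≤ 1`** (`[δ, a] = (δ a)·`).
[cite: EGAIV4, Prop. 16.8.8 (with 16.8.2: Diff^1 and derivations)] -/
theorem Derivation.isDiffOpLE_one (δ : Derivation R A A) : IsDiffOpLE R 1 (δ : A →ₗ[R] A) :=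
  fun a => by rw [commMul_derivation]; exact isDiffOpLE_mulLeft _

/-! ### The `A`-module `Diff^{≤ n}_{A/R}` -/

variable (R A)

/-- **`diffOp R A n = Diff^{≤ n}_{A/R}`**: the differential operators of order `≤ n` of the
`R`-algebra `A` into itself, as an `A`-submodule of `A →ₗ[R] A` (`A` acting by
post-multiplication, `(b • D) t = b * D t`). [cite: EGAIV4, Déf. 16.8.1 and Prop. 16.8.8] -/
def diffOp (n : ℕ) : Submodule A (A →ₗ[R] A) where
  carrier := {D | IsDiffOpLE R n D}
  zero_mem' := IsDiffOpLE.zero n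
  add_mem' := IsDiffOpLE.add
  smul_mem' := fun b _ hD => hD.smul b

variable {R A}

/-- Membership in `diffOp` is `IsDiffOpLE` (definitional). [cite: EGAIV4, Déf. 16.8.1] -/
@[simp] theorem mem_diffOp_iff {n : ℕ} {D : A →ₗ[R] A} : D ∈ diffOp R A n ↔ IsDiffOpLE R n D :=
  Iff.rfl

/-- The increasing filtration `Diff^{≤ 0} ⊆ Diff^{≤ 1} ⊆ ⋯`. [cite: EGAIV4, Déf. 16.8.1] -/
theorem diffOp_mono {m n : ℕ} (h : m ≤ n) : diffOp R A m ≤ diffOp R A n :=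
  fun _ hD => IsDiffOpLE.of_le h hD

/-! ### Higher-order Leibniz estimate: `D(P^m) ⊆ P^{m-n}` -/

/-- **An operator of order `≤ n` lowers the `P`-adic order by at most `n`**: `D ∈ Diff^{≤ n}`,
`f ∈ P^m ⇒ D f ∈ P^{m−n}` (induction on `m`: `D (a b) = [D, a] b + a D b` with `[D, a]` of order
`≤ n − 1`). This is the characteristic-free inclusion behind "`Diff^{(r)}(I_n) ⊆ I_{n−r}`" for the
Rees algebra of powers of `P`. [cite: VillamayorU2008ReesDiff, Def. 3.3 (4) and §4.1] -/
theorem IsDiffOpLE.apply_mem_pow_sub (P : Ideal A) :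
    ∀ (m : ℕ) {n : ℕ} {D : A →ₗ[R] A}, IsDiffOpLE R n D → ∀ {f : A}, f ∈ P ^ m → D f ∈ P ^ (m - n)
  | 0, n, D, _, f, _ => by simp
  | m + 1, n, D, hD, f, hf => by
    rw [pow_succ'] at hf
    refine Submodule.mul_induction_on hf (fun a ha b hb => ?_) (fun x y hx hy => ?_)
    · -- `D (a b) = [D, a] b + a • D b`
      have hsplit : D (a * b) = commMul R D a b + a * D b := by
        rw [commMul_apply]; ring
      rw [hsplit]
      refine Ideal.add_mem _ ?_ ?_
      · cases n with
        | zero => rw [hD a, LinearMap.zero_apply]; exact Ideal.zero_mem _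
        | succ n =>
          have := apply_mem_pow_sub P m (hD a) hb
          rwa [Nat.add_sub_add_right]
      · have hDb : D b ∈ P ^ (m - n) := apply_mem_pow_sub P m hD hb
        have h1 : a * D b ∈ P ^ (m - n + 1) := by
          rw [pow_succ']; exact Ideal.mul_mem_mul ha hDb
        exact Ideal.pow_le_pow_right (by omega) h1
    · rw [map_add]; exact Ideal.add_mem _ hx hy

/-! ### The ideals `Diff^{≤ n}(I)` -/

variable (R)

/-- **`diffIdeal R n I = Diff^{≤ n}_{A/R}(I)`**: the ideal generated by the values `D f` of the
differential operators `D` of order `≤ n` on the elements `f ∈ I` (it contains `I`, `D = id`).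
Villamayor's `Diff^{b−1}_k(I)` ("`V(Diff^{b−1}_k(I))` is the closed set of points of `Z` where the
ideal has order at least `b`"), Kollár's `D^n(I)`; in characteristic `0` on a smooth variety it is
the iterated derivative ideal `derivIdealIter R n I`, in general it is larger
(`derivIdeal_le_diffIdeal_one`). [cite: VillamayorU2008ReesDiff, §4.1 (Diff^{b-1}_k(I)) and Def. 4.2] -/
def diffIdeal (n : ℕ) (I : Ideal A) : Ideal A :=
  Ideal.span {x | ∃ D : A →ₗ[R] A, IsDiffOpLE R n D ∧ ∃ f ∈ I, D f = x}

/-- Values of order-`≤ n` operators on `I` lie in `Diff^{≤ n}(I)`. [cite: VillamayorU2008ReesDiff, §4.1] -/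
theorem apply_mem_diffIdeal {n : ℕ} {D : A →ₗ[R] A} (hD : IsDiffOpLE R n D) {I : Ideal A} {f : A}
    (hf : f ∈ I) : D f ∈ diffIdeal R n I :=
  Ideal.subset_span ⟨D, hD, f, hf, rfl⟩

/-- `I ⊆ Diff^{≤ n}(I)` (the identity has order `0 ≤ n`). [cite: VillamayorU2008ReesDiff, §4.1] -/
theorem le_diffIdeal (n : ℕ) (I : Ideal A) : I ≤ diffIdeal R n I := fun f hf => by
  simpa using apply_mem_diffIdeal R (isDiffOpLE_id.of_le (Nat.zero_le n)) hf

/-- `Diff^{≤ n}(I) ⊆ J` iff `J` contains every `D f`, `D ∈ Diff^{≤ n}`, `f ∈ I`. [folklore] -/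
theorem diffIdeal_le_iff {n : ℕ} {I J : Ideal A} :
    diffIdeal R n I ≤ J ↔ ∀ D : A →ₗ[R] A, IsDiffOpLE R n D → ∀ f ∈ I, D f ∈ J := by
  constructor
  · intro h D hD f hf
    exact h (apply_mem_diffIdeal R hD hf)
  · intro h
    refine Ideal.span_le.mpr ?_
    rintro _ ⟨D, hD, f, hf, rfl⟩
    exact h D hD f hf

/-- `Diff^{≤ n}(I)` is monotone in `I`. [folklore] -/
theorem diffIdeal_mono (n : ℕ) {I J : Ideal A} (h : I ≤ J) : diffIdeal R n I ≤ diffIdeal R n J :=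
  (diffIdeal_le_iff R).mpr fun _ hD _ hf => apply_mem_diffIdeal R hD (h hf)

/-- `Diff^{≤ m}(I) ⊆ Diff^{≤ n}(I)` for `m ≤ n`. [cite: VillamayorU2008ReesDiff, Remark 2.8 (Diff^N ⊆ Diff^{N+1})] -/
theorem diffIdeal_mono_left {m n : ℕ} (h : m ≤ n) (I : Ideal A) : diffIdeal R m I ≤ diffIdeal R n I :=
  (diffIdeal_le_iff R).mpr fun _ hD _ hf => apply_mem_diffIdeal R (hD.of_le h) hf

/-- **`Diff^{≤ 0}(I) = I`** (order-`0` operators are multiplications). [cite: EGAIV4, Déf. 16.8.1] -/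
theorem diffIdeal_zero (I : Ideal A) : diffIdeal R 0 I = I := by
  refine le_antisymm ((diffIdeal_le_iff R).mpr fun D hD f hf => ?_) (le_diffIdeal R 0 I)
  rw [isDiffOpLE_zero_iff_eq_mulLeft.1 hD, LinearMap.mulLeft_apply]
  exact Ideal.mul_mem_left _ _ hf

/-- `Diff^{≤ n}(A) = A`. [folklore] -/
theorem diffIdeal_top (n : ℕ) : diffIdeal R n (⊤ : Ideal A) = ⊤ :=
  top_le_iff.mp (le_diffIdeal R n ⊤)

/-- `Diff^{≤ n}(0) = 0`. [folklore] -/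
theorem diffIdeal_bot (n : ℕ) : diffIdeal R n (⊥ : Ideal A) = ⊥ := by
  refine le_bot_iff.mp ((diffIdeal_le_iff R).mpr fun D _ f hf => ?_)
  rw [Ideal.mem_bot] at hf ⊢
  rw [hf, map_zero]

/-- **The first-order derivative ideal is contained in `Diff^{≤ 1}(I)`**: `𝒟(I) ⊆ Diff^{≤ 1}(I)`
(derivations have order `≤ 1`). In characteristic `p > 0` the inclusion is strict in general
(`𝒟((x^p)) = (x^p)` while `D^{(p)} x^p = 1`). [cite: VillamayorU2008ReesDiff, §4.1] -/
theorem derivIdeal_le_diffIdeal_one (I : Ideal A) : derivIdeal R I ≤ diffIdeal R 1 I :=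
  (derivIdeal_le_iff R).mpr
    ⟨le_diffIdeal R 1 I, fun δ _ hf => apply_mem_diffIdeal R (Derivation.isDiffOpLE_one δ) hf⟩

/-- **`I ⊆ P^m ⇒ Diff^{≤ n}(I) ⊆ P^{m−n}`** — the characteristic-free half of the order criterion:
at `P = 𝔪_x`, `ord_x I ≥ m ⇒ Diff^{≤ m−1}(I) ⊆ 𝔪_x` (and `ord_x Diff^{≤ n}(I) ≥ ord_x I − n`).
[cite: VillamayorU2008ReesDiff, §4.1 (Diff^{b-1}_k(I) proper iff order ≥ b)] -/
theorem diffIdeal_le_pow_sub {I P : Ideal A} {m : ℕ} (h : I ≤ P ^ m) (n : ℕ) :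
    diffIdeal R n I ≤ P ^ (m - n) :=
  (diffIdeal_le_iff R).mpr fun _ hD _ hf => hD.apply_mem_pow_sub P m (h hf)

/-- In particular `ord_P I ≥ n + 1 ⇒ Diff^{≤ n}(I) ⊆ P`. [cite: VillamayorU2008ReesDiff, §4.1] -/
theorem diffIdeal_le_of_le_pow_succ {I P : Ideal A} {n : ℕ} (h : I ≤ P ^ (n + 1)) :
    diffIdeal R n I ≤ P := by
  simpa using diffIdeal_le_pow_sub R h n

end General

end Literature.AlgebraicGeometry.Resolution
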